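import Mathlib

/-!
# `HyperbolicEnd` (stmt-SmoothPoincare4-7825), line `Sketch`, negative side — Ahlfors line test against the neck weight

Helper for `Theorems/HyperbolicEnd/Negative/FrozenFill.lean` (frozen-J certificate filling fails
in complex dimension one). Statement registered on the crux item (stub helper_neckLineTest).

**The line test.** Let `λ` be `C²` near `w` with `λ(w) > 0` and
`2c' λ³ ≤ λ Δλ - |∇λ|²` at `w`, and suppose `Q(z) = λ(z) cos²(α(re z - s_b))` has a local maximum
at `w` with `cos(α(re w - s_b)) > 0`.  Restricting `Q` to the two real lines `t ↦ w + t` and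
`t ↦ w + tI` and writing out the first- and second-order conditions at `t = 0` (`line_test`),
then combining them with the curvature inequality and `Δλ = ∂ₓₓλ + ∂_yyλ` by elementary algebra
(`algebra_step`, using `h'² - h h'' = 2α² h` for the weight `h = cos²(α(s - s_b))`), one gets
`c' · Q(w) ≤ α²`: the comparison of `λ` with the neck supersolution `α²/(c' cos²(α(s - s_b)))`.
The one-variable calculus is adapted from the landed Ahlfors–Osserman stub
(`Theorems/SullivanDualHyperbolicEndStubAhlforsOsserman.lean`), localised to `ContDiffAt`.
-/

noncomputable section

-- the prescribed namespace `Summit.<P>.<Sub>.…` duplicates `SmoothPoincare4` (P = Sub)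
set_option linter.dupNamespace false

open scoped ContDiff Topology Real
open Laplacian Set Filter Metric Complex

namespace Summit.SmoothPoincare4.SmoothPoincare4.Theorems.HyperbolicEnd.Negative

/-! ### One-variable calculus along real lines in `ℂ` (local versions) -/

/-- Derivative of `f : ℂ → F` along the real line `t ↦ z + t • v` at a parameter `t` where `f` is
differentiable (adapted from the Ahlfors–Osserman stub's `hasDerivAt_line`). -/
private theorem hasDerivAt_line {F : Type*} [NormedAddCommGroup F] [NormedSpace ℝ F]
    {f : ℂ → F} (z v : ℂ) (t : ℝ) (hf : DifferentiableAt ℝ f (z + t • v)) :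
    HasDerivAt (fun s : ℝ => f (z + s • v)) (fderiv ℝ f (z + t • v) v) t := by
  have hl : HasDerivAt (fun s : ℝ => z + s • v) v t := by
    simpa using ((hasDerivAt_id t).smul_const v).const_add z
  exact hf.hasFDerivAt.comp_hasDerivAt t hl

/-- Second derivative along the line: for `f` of class `C²` at `z`, `t ↦ Df(z + t v) v` has
derivative `D²f(z)(v, v)` at `t = 0`. -/
private theorem hasDerivAt_line_fderiv {f : ℂ → ℝ} {z : ℂ} (hf : ContDiffAt ℝ 2 f z) (v : ℂ) :
    HasDerivAt (fun s : ℝ => fderiv ℝ f (z + s • v) v) (fderiv ℝ (fderiv ℝ f) z v v) 0 := by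
  have hD : DifferentiableAt ℝ (fderiv ℝ f) z :=
    (hf.fderiv_right (m := 1) (by norm_num)).differentiableAt one_ne_zero
  have hl : HasDerivAt (fun s : ℝ => z + s • v) v 0 := by
    simpa using ((hasDerivAt_id (0 : ℝ)).smul_const v).const_add z
  have hD' : HasFDerivAt (fderiv ℝ f) (fderiv ℝ (fderiv ℝ f) z) (z + (0 : ℝ) • v) := by
    rw [zero_smul, add_zero]
    exact hD.hasFDerivAt
  have h1 : HasDerivAt (fun s : ℝ => fderiv ℝ f (z + s • v)) (fderiv ℝ (fderiv ℝ f) z v) 0 :=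
    hD'.comp_hasDerivAt (0 : ℝ) hl
  have h2 := h1.clm_apply (hasDerivAt_const (0 : ℝ) v)
  simpa using h2

/-- A function of class `C²` at `z` is differentiable at the points `z + t v` for `t` near `0`. -/
private theorem eventually_differentiableAt_line {f : ℂ → ℝ} {z : ℂ} (hf : ContDiffAt ℝ 2 f z)
    (v : ℂ) : ∀ᶠ t in 𝓝 (0 : ℝ), DifferentiableAt ℝ f (z + t • v) := by
  have hev : ∀ᶠ y in 𝓝 z, ContDiffAt ℝ 2 f y := hf.eventually (by simp)
  have hl : Continuous fun s : ℝ => z + s • v := by fun_prop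
  have ht : Tendsto (fun s : ℝ => z + s • v) (𝓝 0) (𝓝 z) := by
    simpa using hl.tendsto 0
  exact (ht.eventually hev).mono fun t ht => ht.differentiableAt two_ne_zero

/-- One-dimensional second-derivative test, necessary form: at a local maximum where `φ` is
continuous, `φ'' ≤ 0` (otherwise the sufficient second-derivative test makes the point also a
local minimum, `φ` is locally constant and `φ'' = 0` there). Copied from the Ahlfors–Osserman
stub. -/
private theorem deriv_deriv_nonpos_of_isLocalMax {φ : ℝ → ℝ} {t₀ : ℝ} (h : IsLocalMax φ t₀)
    (hc : ContinuousAt φ t₀) : deriv (deriv φ) t₀ ≤ 0 := by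
  by_contra hpos
  have hpos' : 0 < deriv (deriv φ) t₀ := lt_of_not_ge hpos
  have hmin : IsLocalMin φ t₀ := isLocalMin_of_deriv_deriv_pos hpos' h.deriv_eq_zero hc
  have heq : φ =ᶠ[𝓝 t₀] fun _ => φ t₀ :=
    (h.and hmin).mono fun s hs => le_antisymm hs.1 hs.2
  have h2 : deriv (deriv φ) t₀ = deriv (deriv fun _ : ℝ => φ t₀) t₀ := heq.deriv.deriv_eq
  rw [h2] at hpos'
  simp at hpos'

/-- First- and second-order conditions at a local maximum, for a function with a derivative `ψ'`
near the point which is itself differentiable at the point: `ψ'(t₀) = 0` and `ψ''(t₀) ≤ 0`. -/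
private theorem deriv_test {ψ ψ' : ℝ → ℝ} {d t₀ : ℝ} (hψ : ∀ᶠ t in 𝓝 t₀, HasDerivAt ψ (ψ' t) t)
    (hψ' : HasDerivAt ψ' d t₀) (hmax : IsLocalMax ψ t₀) : ψ' t₀ = 0 ∧ d ≤ 0 := by
  have h0 : HasDerivAt ψ (ψ' t₀) t₀ := hψ.self_of_nhds
  have h1 : deriv ψ =ᶠ[𝓝 t₀] ψ' := hψ.mono fun t ht => ht.deriv
  refine ⟨hmax.hasDerivAt_eq_zero h0, ?_⟩
  have h2 : deriv (deriv ψ) t₀ = d := by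
    rw [h1.deriv_eq]
    exact hψ'.deriv
  rw [← h2]
  exact deriv_deriv_nonpos_of_isLocalMax hmax h0.continuousAt

/-! ### The neck weight along a line -/

/-- Derivative of the weight `s ↦ cos²(a + b s)`. -/
private theorem hasDerivAt_weight (a b t : ℝ) :
    HasDerivAt (fun s : ℝ => Real.cos (a + b * s) ^ 2)
      (-2 * b * Real.cos (a + b * t) * Real.sin (a + b * t)) t := by
  have hθ : HasDerivAt (fun s : ℝ => a + b * s) b t := by
    simpa using ((hasDerivAt_id t).const_mul b).const_add a
  have h := (hθ.cos).fun_pow 2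
  refine h.congr_deriv ?_
  push_cast
  ring

/-- Derivative of `s ↦ -2b cos(a + b s) sin(a + b s)`, the derivative of the weight. -/
private theorem hasDerivAt_weight' (a b t : ℝ) :
    HasDerivAt (fun s : ℝ => -2 * b * Real.cos (a + b * s) * Real.sin (a + b * s))
      (-2 * b ^ 2 * (Real.cos (a + b * t) ^ 2 - Real.sin (a + b * t) ^ 2)) t := by
  have hθ : HasDerivAt (fun s : ℝ => a + b * s) b t := by
    simpa using ((hasDerivAt_id t).const_mul b).const_add a
  have h := ((hθ.cos).const_mul (-2 * b)).fun_mul hθ.sin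
  refine h.congr_deriv ?_
  ring

/-! ### The line test at a local maximum of `f · cos²(α(re z - s_b))` -/

/-- **Line test.** At a local maximum `z` of `w ↦ f(w) cos²(α(re w - s_b))` (`f` of class `C²`
at `z`), the first derivative of the restriction to the real line `t ↦ z + t v` vanishes and the
second one is `≤ 0`; written out with `C = cos(α(re z - s_b))`, `S = sin(α(re z - s_b))`,
`b = α re v` (so that the weight along the line is `cos²(α(re z - s_b) + b t)` with first
derivative `-2bCS` and second derivative `-2b²(C² - S²)` at `t = 0`). -/
private theorem line_test {f : ℂ → ℝ} {z : ℂ} (hf : ContDiffAt ℝ 2 f z) {α s_b : ℝ}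
    (hmax : IsLocalMax (fun w => f w * Real.cos (α * (w.re - s_b)) ^ 2) z) (v : ℂ) :
    fderiv ℝ f z v * Real.cos (α * (z.re - s_b)) ^ 2 +
        f z * (-2 * (α * v.re) * Real.cos (α * (z.re - s_b)) * Real.sin (α * (z.re - s_b))) = 0 ∧
      fderiv ℝ (fderiv ℝ f) z v v * Real.cos (α * (z.re - s_b)) ^ 2 +
          fderiv ℝ f z v *
            (-2 * (α * v.re) * Real.cos (α * (z.re - s_b)) * Real.sin (α * (z.re - s_b))) +
        (fderiv ℝ f z v *
            (-2 * (α * v.re) * Real.cos (α * (z.re - s_b)) * Real.sin (α * (z.re - s_b))) +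
          f z * (-2 * (α * v.re) ^ 2 *
            (Real.cos (α * (z.re - s_b)) ^ 2 - Real.sin (α * (z.re - s_b)) ^ 2))) ≤ 0 := by
  set a : ℝ := α * (z.re - s_b) with ha
  set b : ℝ := α * v.re with hb
  -- the restriction of the weight to the line is `cos²(a + b t)`
  have hfun : (fun s : ℝ => f (z + s • v) * Real.cos (α * ((z + s • v).re - s_b)) ^ 2) =
      fun s => f (z + s • v) * Real.cos (a + b * s) ^ 2 := by
    funext s
    simp only [ha, hb, Complex.add_re, Complex.smul_re, smul_eq_mul]
    ring_nf
  -- the restriction has a local maximum at `0`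
  have hmax0 : IsLocalMax (fun s : ℝ => f (z + s • v) * Real.cos (α * ((z + s • v).re - s_b)) ^ 2)
      0 := by
    have hz : IsLocalMax (fun w => f w * Real.cos (α * (w.re - s_b)) ^ 2)
        ((fun s : ℝ => z + s • v) 0) := by
      simpa using hmax
    exact hz.comp_continuous (g := fun s : ℝ => z + s • v) (by fun_prop)
  rw [hfun] at hmax0
  -- derivatives along the line
  have hf1 : ∀ᶠ t in 𝓝 (0 : ℝ),
      HasDerivAt (fun s : ℝ => f (z + s • v)) (fderiv ℝ f (z + t • v) v) t :=
    (eventually_differentiableAt_line hf v).mono fun t ht => hasDerivAt_line z v t ht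
  have hf10 : HasDerivAt (fun s : ℝ => f (z + s • v)) (fderiv ℝ f (z + (0 : ℝ) • v) v) 0 :=
    hf1.self_of_nhds
  have hf2 := hasDerivAt_line_fderiv hf v
  have hψ : ∀ᶠ t in 𝓝 (0 : ℝ), HasDerivAt (fun s : ℝ => f (z + s • v) * Real.cos (a + b * s) ^ 2)
      (fderiv ℝ f (z + t • v) v * Real.cos (a + b * t) ^ 2 +
        f (z + t • v) * (-2 * b * Real.cos (a + b * t) * Real.sin (a + b * t))) t :=
    hf1.mono fun t ht => ht.fun_mul (hasDerivAt_weight a b t)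
  have hψ' := (hf2.fun_mul (hasDerivAt_weight a b 0)).fun_add
    (hf10.fun_mul (hasDerivAt_weight' a b 0))
  obtain ⟨h1, h2⟩ := deriv_test hψ hψ' hmax0
  simp only [zero_smul, add_zero, mul_zero] at h1 h2
  exact ⟨h1, h2⟩

/-! ### The pointwise algebra -/

/-- **The pointwise algebra** of the comparison with the neck weight at a positive interior
maximum: with `L = λ(w) > 0`, `C = cos > 0`, `S = sin`, the first-order relation in the
direction `1`, the two second-order inequalities and the curvature hypothesis give
`c L C² ≤ α²` (the key identity being `(2αCS)² + 2α²C²(C² - S²) = 2α²C²`). -/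
private theorem algebra_step {c L C S α p q s u : ℝ} (hL : 0 < L) (hC : 0 < C)
    (hSC : S ^ 2 + C ^ 2 = 1)
    (ha1 : p * C ^ 2 + L * (-2 * α * C * S) = 0)
    (hb1 : s * C ^ 2 + 2 * (p * (-2 * α * C * S)) + L * (-2 * α ^ 2 * (C ^ 2 - S ^ 2)) ≤ 0)
    (hb2 : u * C ^ 2 ≤ 0)
    (hd : 2 * c * L ^ 3 ≤ L * (s + u) - (p ^ 2 + q ^ 2)) :
    c * (L * C ^ 2) ≤ α ^ 2 := by
  have hC2 : 0 < C ^ 2 := by positivity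
  have hu : u ≤ 0 := by
    by_contra h
    exact absurd hb2 (not_le.2 (mul_pos (lt_of_not_ge h) hC2))
  have hLu : L * u ≤ 0 := mul_nonpos_of_nonneg_of_nonpos hL.le hu
  -- `2 c L³ ≤ L s - p²`
  have hd' : 2 * c * L ^ 3 ≤ L * s - p ^ 2 := by nlinarith [sq_nonneg q]
  -- first-order relation: `p C² = 2 α L C S`
  have ha1' : p * C ^ 2 = 2 * α * L * C * S := by linear_combination ha1
  -- multiply the curvature inequality by `C⁴ ≥ 0` and the second-order one by `L C² ≥ 0`
  have i1 : 2 * c * L ^ 3 * (C ^ 2) ^ 2 ≤ (L * s - p ^ 2) * (C ^ 2) ^ 2 :=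
    mul_le_mul_of_nonneg_right hd' (by positivity)
  have i2 := mul_nonpos_of_nonneg_of_nonpos (mul_nonneg hL.le hC2.le) hb1
  have e1 : p ^ 2 * (C ^ 2) ^ 2 = 4 * α ^ 2 * L ^ 2 * C ^ 2 * S ^ 2 := by
    linear_combination (p * C ^ 2 + 2 * α * L * C * S) * ha1'
  have e2 : L * C ^ 2 * (2 * (p * (-2 * α * C * S))) = -8 * α ^ 2 * L ^ 2 * C ^ 2 * S ^ 2 := by
    linear_combination (-4 * α * L * C * S) * ha1'
  have e3 : α ^ 2 * L ^ 2 * C ^ 2 * S ^ 2 + α ^ 2 * L ^ 2 * C ^ 2 * C ^ 2 =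
      α ^ 2 * L ^ 2 * C ^ 2 := by
    linear_combination (α ^ 2 * L ^ 2 * C ^ 2) * hSC
  have key : 2 * c * L ^ 3 * (C ^ 2) ^ 2 ≤ 2 * α ^ 2 * L ^ 2 * C ^ 2 := by
    linarith [i1, i2, e1, e2, e3]
  have h2L : 0 < 2 * L ^ 2 * C ^ 2 := by positivity
  have key' : 2 * L ^ 2 * C ^ 2 * (c * (L * C ^ 2)) ≤ 2 * L ^ 2 * C ^ 2 * α ^ 2 := by
    nlinarith [key]
  exact le_of_mul_le_mul_left key' h2L

/-! ### The helper -/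

/-- helper (W-B): Ahlfors line test against the neck weight `cos²(α(re z - s_b))`.  At an interior
local maximum `w` of `Q = λ · cos²(α(re z - s_b))` with `λ(w) > 0`, `cos(α(re w - s_b)) > 0`, for
`λ` of class `C²` at `w` satisfying the curvature inequality `2c'λ³ ≤ λΔλ - |∇λ|²` at `w`, one has
`c' Q(w) ≤ α²`. -/
theorem helper_neckLineTest (lam : ℂ → ℝ) (w : ℂ) (α s_b c' : ℝ)
    (hlam : ContDiffAt ℝ 2 lam w) (hpos : 0 < lam w)
    (hcos : 0 < Real.cos (α * (w.re - s_b)))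
    (hineq : 2 * c' * lam w ^ 3 ≤
      lam w * (Δ lam) w - ((fderiv ℝ lam w 1) ^ 2 + (fderiv ℝ lam w Complex.I) ^ 2))
    (hmax : IsLocalMax (fun z => lam z * Real.cos (α * (z.re - s_b)) ^ 2) w) :
    c' * (lam w * Real.cos (α * (w.re - s_b)) ^ 2) ≤ α ^ 2 := by
  obtain ⟨ha1, hb1⟩ := line_test hlam hmax 1
  obtain ⟨ha2, hb2⟩ := line_test hlam hmax Complex.I
  simp only [Complex.one_re, Complex.I_re, mul_one] at ha1 hb1 ha2 hb2
  have hΔ : (Δ lam) w = fderiv ℝ (fderiv ℝ lam) w 1 1 +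
      fderiv ℝ (fderiv ℝ lam) w Complex.I Complex.I := by
    rw [InnerProductSpace.laplacian_eq_iteratedFDeriv_complexPlane lam]
    simp [iteratedFDeriv_two_apply]
  rw [hΔ] at hineq
  exact algebra_step (c := c') hpos hcos (Real.sin_sq_add_cos_sq _)
    (p := fderiv ℝ lam w 1) (q := fderiv ℝ lam w Complex.I)
    (s := fderiv ℝ (fderiv ℝ lam) w 1 1)
    (u := fderiv ℝ (fderiv ℝ lam) w Complex.I Complex.I)
    (by linear_combination ha1) (by linarith) (by linarith) hineq

end Summit.SmoothPoincare4.SmoothPoincare4.Theorems.HyperbolicEnd.Negative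

end
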